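import Summits.QuantumFields.YangMills.Theorems.ComplexCouplingChannelFreeEnergyWindowChannelStubLocalWindowOfEnvelope

/-!
# A-priori envelope `|log ‖Z_P‖| ≤ A · P⁴` on compact sub-channels

Helper file for the crux `FreeEnergyWindowChannel` (item `stmt-QuantumFields-18842`, route
`ComplexCouplingChannel` of `QuantumFields/YangMills`), line `Sketch` (transport), stub `stub_logEnvelope`.
Pure one-variable complex analysis.

Let `Z P : ℂ → ℂ` (`P : ℕ`) be holomorphic on an open preconnected `D ∋ 0`, normalised by `Z P 0 = 1`,
zero-free on `D` for `P ≥ P₀ ≥ 1`, with the growth bound `‖Z P z‖ ≤ exp (a P⁴ ‖z‖)` (`a ≥ 0`).  Then on every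
compact `K ⊆ D` there is `A ≥ 0` with `|log ‖Z P z‖| ≤ A · P⁴` for all `P ≥ P₀`, `z ∈ K`.

Proof.  POINTWISE (`exists_abs_log_norm_le_on_ball`): join `0` to `y ∈ D` by a path in `D`, thicken its compact
range inside `D` (`IsCompact.exists_cthickening_subset_open`, radius `δ`), and cover it by a chain of discs
`ball (c j) δ ⊆ D`, `c 0 = 0`, `c N = y`, with consecutive centres closer than `δ / 2` (uniform continuity of
the extended path).  All centres lie in a fixed closed ball `closedBall 0 R₀`, so the growth bound gives the
ENVELOPE `‖Z P‖ ≤ exp (a (R₀ + δ) P⁴)` on every disc of the chain.  By induction on `j`, the local two-sided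
lemma `abs_log_norm_le_of_norm_le_of_ne_zero` (Borel–Carathéodory for the local holomorphic logarithm, tree file
`…StubLocalWindowOfEnvelope`) propagates a FLOOR at the centre `c j` to the two-sided bound
`|log ‖Z P z‖| ≤ α_j P⁴` on `ball (c j) (δ/2) ∋ c (j + 1)`, starting from `‖Z P (c 0)‖ = ‖Z P 0‖ = 1`; the
constants `α_j` do not depend on `P` (the additive `+ 5` is absorbed by `5 ≤ 5 P⁴`, as `P ≥ 1`).
COMPACT `K ⊆ D` (`stub_logEnvelope`): finitely many of the balls `ball y (δ_y / 2)` cover `K`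
(`IsCompact.elim_nhds_subcover`); take the sum of the finitely many nonnegative constants.

References: tree `abs_log_norm_le_of_norm_le_of_ne_zero`
(`ComplexCouplingChannelFreeEnergyWindowChannelStubLocalWindowOfEnvelope.lean`); the chain bookkeeping is
adapted from `exists_exponent_norm_le_on_ball`
(`ComplexCouplingChannelFreeEnergyWindowChannelStubChainOnCompacts.lean`).
-/

open Complex Metric Set Filter Topology

namespace Summit.QuantumFields.YangMills.Theorems.FreeEnergyWindowChannel

open Summit.QuantumFields.YangMills.Theorems.ComplexCouplingChannel

/-- **A-priori envelope along a chain of discs, local form.**  Let `D ⊆ ℂ` be open and preconnected with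
`0 ∈ D`, `P₀ ≥ 1`, and let `Z P` (`P : ℕ`) be holomorphic on `D` with `Z P 0 = 1`,
`‖Z P z‖ ≤ exp (a P⁴ ‖z‖)` (`a ≥ 0`) and `Z P` zero-free on `D` for `P ≥ P₀`.  Then every `y ∈ D` has a ball
`ball y s` (`s > 0`) and a constant `A ≥ 0` with `|log ‖Z P z‖| ≤ A · P⁴` for all `P ≥ P₀`, `z ∈ ball y s`.
Proof: chain of discs from `0` to `y` inside `D` (path, closed thickening of its range, uniform continuity),
and induction along the chain with `abs_log_norm_le_of_norm_le_of_ne_zero`, the floor at each new centre being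
supplied by the two-sided bound on the previous disc. [folklore] -/
theorem exists_abs_log_norm_le_on_ball {Z : ℕ → ℂ → ℂ} {a : ℝ} {D : Set ℂ} {P₀ : ℕ} (ha : 0 ≤ a)
    (hD : IsOpen D) (hDc : IsPreconnected D) (h0 : (0 : ℂ) ∈ D) (hP₀ : 1 ≤ P₀)
    (hZ : ∀ P : ℕ, DifferentiableOn ℂ (Z P) D) (hZ1 : ∀ P : ℕ, Z P 0 = 1)
    (hgr : ∀ (P : ℕ) (z : ℂ), ‖Z P z‖ ≤ Real.exp (a * (P : ℝ) ^ 4 * ‖z‖))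
    (hfree : ∀ P : ℕ, P₀ ≤ P → ∀ z ∈ D, Z P z ≠ 0) {y : ℂ} (hy : y ∈ D) :
    ∃ s : ℝ, 0 < s ∧ ∃ A : ℝ, 0 ≤ A ∧ ∀ P : ℕ, P₀ ≤ P → ∀ z ∈ ball y s,
      |Real.log ‖Z P z‖| ≤ A * (P : ℝ) ^ 4 := by
  -- adapted from `exists_exponent_norm_le_on_ball` (tree, StubChainOnCompacts file)
  -- a path from `0` to `y` inside `D`
  have hpath : IsPathConnected D := hD.isConnected_iff_isPathConnected.1 ⟨⟨0, h0⟩, hDc⟩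
  have hJ : JoinedIn D 0 y := hpath.joinedIn 0 h0 y hy
  set γ : Path (0 : ℂ) y := hJ.somePath with hγ
  have hγD : ∀ t, γ t ∈ D := hJ.somePath_mem
  -- a closed thickening of its compact range inside `D`
  obtain ⟨δ, hδ0, hδD⟩ := (isCompact_range γ.continuous).exists_cthickening_subset_open hD
    (range_subset_iff.2 hγD)
  -- a closed ball around `0` containing the range
  obtain ⟨R₀, hR₀0, hR₀⟩ := (isCompact_range γ.continuous).isBounded.subset_closedBall_lt 0 (0 : ℂ)
  -- the spacing of the chain, from uniform continuity of the extended path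
  obtain ⟨η, hη0, hη⟩ := Metric.uniformContinuous_iff.1 γ.uniformContinuous_extend (δ / 2) (by positivity)
  obtain ⟨k, hk⟩ := exists_nat_one_div_lt hη0
  set N : ℕ := k + 1 with hN
  have hN0 : (0 : ℝ) < N := by rw [hN]; positivity
  have hNinv : 1 / (N : ℝ) < η := by rw [hN]; push_cast; exact hk
  -- the centres
  set c : ℕ → ℂ := fun j => γ.extend ((j : ℝ) / N) with hc
  have hcmem : ∀ j, c j ∈ range γ := fun j => by
    rw [← γ.extend_range]; exact mem_range_self _
  have hc0 : c 0 = 0 := by simp [hc]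
  have hcN : c N = y := by
    simp only [hc]
    rw [div_self hN0.ne', Path.extend_one]
  have hstep : ∀ j : ℕ, dist (c (j + 1)) (c j) < δ / 2 := by
    intro j
    refine hη ?_
    rw [Real.dist_eq, Nat.cast_succ, show ((j : ℝ) + 1) / N - j / N = 1 / N from by ring,
      abs_of_pos (by positivity)]
    exact hNinv
  have hball : ∀ j, ball (c j) δ ⊆ D := fun j =>
    ball_subset_closedBall.trans ((closedBall_subset_cthickening (hcmem j) δ).trans hδD)
  have hcn : ∀ j, ‖c j‖ ≤ R₀ := fun j => mem_closedBall_zero_iff.1 (hR₀ (hcmem j))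
  -- the envelope on the discs of the chain, with a constant independent of `j` and linear in `P⁴`
  have hM0 : 0 ≤ a * (R₀ + δ) := by positivity
  set M : ℝ := a * (R₀ + δ) with hM
  have hup : ∀ (j P : ℕ), ∀ z ∈ ball (c j) δ, ‖Z P z‖ ≤ Real.exp (M * (P : ℝ) ^ 4) := by
    intro j P z hz
    refine (hgr P z).trans (Real.exp_le_exp.2 ?_)
    have hz' : ‖z‖ ≤ R₀ + δ := by
      have h1 : ‖z - c j‖ < δ := mem_ball_iff_norm.1 hz
      calc ‖z‖ = ‖(z - c j) + c j‖ := by rw [sub_add_cancel]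
        _ ≤ ‖z - c j‖ + ‖c j‖ := norm_add_le _ _
        _ ≤ δ + R₀ := add_le_add h1.le (hcn j)
        _ = R₀ + δ := add_comm _ _
    have h2 : 0 ≤ a * (P : ℝ) ^ 4 := by positivity
    calc a * (P : ℝ) ^ 4 * ‖z‖ ≤ a * (P : ℝ) ^ 4 * (R₀ + δ) := mul_le_mul_of_nonneg_left hz' h2
      _ = M * (P : ℝ) ^ 4 := by rw [hM]; ring
  have hP4 : ∀ P : ℕ, P₀ ≤ P → (1 : ℝ) ≤ (P : ℝ) ^ 4 := fun P hP =>
    one_le_pow₀ (by exact_mod_cast hP₀.trans hP)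
  -- propagation along the chain
  have hind : ∀ j : ℕ, ∃ α : ℝ, 0 ≤ α ∧ ∀ P : ℕ, P₀ ≤ P → ∀ z ∈ ball (c j) (δ / 2),
      |Real.log ‖Z P z‖| ≤ α * (P : ℝ) ^ 4 := by
    intro j
    induction j with
    | zero =>
      refine ⟨11 * M + 5, by positivity, ?_⟩
      intro P hP z hz
      have hA : 0 ≤ M * (P : ℝ) ^ 4 := by positivity
      have hlow : Real.exp (-(M * (P : ℝ) ^ 4)) ≤ ‖Z P (c 0)‖ := by
        rw [hc0, hZ1, norm_one]
        exact Real.exp_le_one_iff.2 (neg_nonpos.2 hA)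
      have key := abs_log_norm_le_of_norm_le_of_ne_zero hδ0 hA ((hZ P).mono (hball 0))
        (fun w hw => hfree P hP w (hball 0 hw)) (hup 0 P) hlow z hz
      calc |Real.log ‖Z P z‖| ≤ 11 * (M * (P : ℝ) ^ 4) + 5 := key
        _ ≤ 11 * (M * (P : ℝ) ^ 4) + 5 * (P : ℝ) ^ 4 := by linarith [hP4 P hP]
        _ = (11 * M + 5) * (P : ℝ) ^ 4 := by ring
    | succ j ih =>
      obtain ⟨α, hα0, ih⟩ := ih
      refine ⟨11 * max M α + 5, by positivity, ?_⟩
      intro P hP z hz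
      have hA : 0 ≤ max M α * (P : ℝ) ^ 4 := by positivity
      -- the floor at the new centre, from the two-sided bound on the previous disc
      have hne : Z P (c (j + 1)) ≠ 0 := hfree P hP _ (hball (j + 1) (mem_ball_self hδ0))
      have hih : |Real.log ‖Z P (c (j + 1))‖| ≤ α * (P : ℝ) ^ 4 := ih P hP (c (j + 1)) (hstep j)
      have hαA : α * (P : ℝ) ^ 4 ≤ max M α * (P : ℝ) ^ 4 :=
        mul_le_mul_of_nonneg_right (le_max_right M α) (by positivity)
      have hlow : Real.exp (-(max M α * (P : ℝ) ^ 4)) ≤ ‖Z P (c (j + 1))‖ := by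
        have h1 : -(α * (P : ℝ) ^ 4) ≤ Real.log ‖Z P (c (j + 1))‖ := (abs_le.1 hih).1
        calc Real.exp (-(max M α * (P : ℝ) ^ 4)) ≤ Real.exp (Real.log ‖Z P (c (j + 1))‖) :=
              Real.exp_le_exp.2 (by linarith)
          _ = ‖Z P (c (j + 1))‖ := Real.exp_log (norm_pos_iff.2 hne)
      have hup' : ∀ w ∈ ball (c (j + 1)) δ, ‖Z P w‖ ≤ Real.exp (max M α * (P : ℝ) ^ 4) := fun w hw =>
        (hup (j + 1) P w hw).trans
          (Real.exp_le_exp.2 (mul_le_mul_of_nonneg_right (le_max_left M α) (by positivity)))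
      have key := abs_log_norm_le_of_norm_le_of_ne_zero hδ0 hA ((hZ P).mono (hball (j + 1)))
        (fun w hw => hfree P hP w (hball (j + 1) hw)) hup' hlow z hz
      calc |Real.log ‖Z P z‖| ≤ 11 * (max M α * (P : ℝ) ^ 4) + 5 := key
        _ ≤ 11 * (max M α * (P : ℝ) ^ 4) + 5 * (P : ℝ) ^ 4 := by linarith [hP4 P hP]
        _ = (11 * max M α + 5) * (P : ℝ) ^ 4 := by ring
  -- conclusion at `y = c N`, on the last disc
  obtain ⟨α, hα0, hα⟩ := hind N
  refine ⟨δ / 2, by positivity, α, hα0, ?_⟩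
  intro P hP z hz
  rw [← hcN] at hz
  exact hα P hP z hz

/-- **A-PRIORI ENVELOPE `|log ‖Z_P‖| ≤ A · P⁴` ON COMPACT SUB-CHANNELS** (stub `stub_logEnvelope` of line
`Sketch`, crux `FreeEnergyWindowChannel`).  Let `D ⊆ ℂ` be open and preconnected with `0 ∈ D`, `P₀ ≥ 1`, and
let `Z P` (`P : ℕ`) be holomorphic on `D`, normalised by `Z P 0 = 1`, with the growth bound
`‖Z P z‖ ≤ exp (a P⁴ ‖z‖)` (`a ≥ 0`) and zero-free on `D` for `P ≥ P₀`.  Then for every compact `K ⊆ D` there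
is `A ≥ 0` with `|log ‖Z P z‖| ≤ A · P⁴` for all `P ≥ P₀` and `z ∈ K`.  Proof: at every `y ∈ D` the local
chain estimate `exists_abs_log_norm_le_on_ball` (Borel–Carathéodory for local holomorphic logarithms along a
chain of discs from `0`, where `‖Z P 0‖ = 1`) gives a ball `ball y s_y` and a constant `A_y ≥ 0`; finitely many
of these balls cover `K` (`IsCompact.elim_nhds_subcover`); take the sum of the finitely many `A_y`. [folklore] -/
theorem stub_logEnvelope :
    ∀ (Z : ℕ → ℂ → ℂ) (a : ℝ) (D : Set ℂ) (P₀ : ℕ), 0 ≤ a → IsOpen D → IsPreconnected D → (0 : ℂ) ∈ D → 1 ≤ P₀ →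
      (∀ P : ℕ, DifferentiableOn ℂ (Z P) D) → (∀ P : ℕ, Z P 0 = 1) →
      (∀ (P : ℕ) (z : ℂ), ‖Z P z‖ ≤ Real.exp (a * (P : ℝ) ^ 4 * ‖z‖)) →
      (∀ P : ℕ, P₀ ≤ P → ∀ z ∈ D, Z P z ≠ 0) →
      ∀ K : Set ℂ, IsCompact K → K ⊆ D →
        ∃ A : ℝ, 0 ≤ A ∧ ∀ P : ℕ, P₀ ≤ P → ∀ z ∈ K, |Real.log ‖Z P z‖| ≤ A * (P : ℝ) ^ 4 := by
  intro Z a D P₀ ha hD hDc h0 hP₀ hZ hZ1 hgr hfree K hK hKD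
  -- pointwise data: a radius and a constant at every point of `D`
  have hpt : ∀ y ∈ D, ∃ s : ℝ, 0 < s ∧ ∃ A : ℝ, 0 ≤ A ∧ ∀ P : ℕ, P₀ ≤ P → ∀ z ∈ ball y s,
      |Real.log ‖Z P z‖| ≤ A * (P : ℝ) ^ 4 :=
    fun y hy => exists_abs_log_norm_le_on_ball ha hD hDc h0 hP₀ hZ hZ1 hgr hfree hy
  choose! s hs0 A hA0 hA using hpt
  -- a finite subcover of `K` by the balls `ball y (s y)`, `y ∈ K`
  obtain ⟨t, htK, hcover⟩ := hK.elim_nhds_subcover (fun y => ball y (s y))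
    (fun y hy => ball_mem_nhds y (hs0 y (hKD hy)))
  have htA : ∀ y ∈ t, 0 ≤ A y := fun y hy => hA0 y (hKD (htK y hy))
  -- the sum of the finitely many constants
  refine ⟨∑ y ∈ t, A y, Finset.sum_nonneg htA, ?_⟩
  intro P hP z hz
  obtain ⟨y, hyt, hzy⟩ := mem_iUnion₂.1 (hcover hz)
  have hyD : y ∈ D := hKD (htK y hyt)
  calc |Real.log ‖Z P z‖| ≤ A y * (P : ℝ) ^ 4 := hA y hyD P hP z hzy
    _ ≤ (∑ y ∈ t, A y) * (P : ℝ) ^ 4 :=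
      mul_le_mul_of_nonneg_right (Finset.single_le_sum htA hyt) (by positivity)

end Summit.QuantumFields.YangMills.Theorems.FreeEnergyWindowChannel
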